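import Summits.QuantumAdvantage.QuantumAdvantage.Theses.LinnikCubicClassGroups
import Literature.Computability.Cryptography.CubicClassSamplingSpecs
import Literature.Computability.Cryptography.CubicClassStageParams
import Literature.Computability.Cryptography.ShiftSamplingReadout
import Literature.Computability.Complexity.CodeFPListKit
import Literature.Computability.Complexity.CodeFPStrings
import Literature.Computability.Complexity.CodeFPStringKit
import Literature.Computability.Complexity.CodeFPBudgets

/-!
# Crux `LinnikCubicClassGroups.PureCubicClassGroupFBQP` (stmt-QuantumAdvantage-11544) — ASM programs (Tab)

Line `arakelov-giant-step-cycle`, stub `stub_classStageAssembly` (S5b-ASM), helper `classStage_tab`: the TABLE program of the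
class-group stage in the shape the quantum family consumes (`tab : {0,1}* → ℕ → {0,1}*`, polynomial time in the code
`⟨z, bin v⟩`). The family's input string is `z = ⟨⟨c₁₉, bin cap⟩, pad⟩` with `c₁₉` the code of the nineteen instance
fields (the first component of `CubicClassSampling.tableArgsE`); the program reshuffles `⟨⟨⟨c₁₉, bin cap⟩, pad⟩, bin v⟩`
into the argument code `⟨c₁₉, ⟨bin cap, bin v⟩⟩ = tableArgsE (t, cap, v)` by the string projections `Brick.fstF/sndF`
(in `FP`, `fstF_boolPair`/`sndF_boolPair`) and applies the given `FP` function of the class table `classTableOpQ`.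
Pure plumbing; definition-free.
-/

-- the problem namespace repeats the summit name (`QuantumAdvantage.QuantumAdvantage`)
set_option linter.dupNamespace false

namespace Summit.QuantumAdvantage.QuantumAdvantage.Theorems.LinnikCubicClassGroups

open Computability (encodeNat decodeNat)
open Literature.Computability.Complexity (boolPair boolUnpair CodeFP FP encodingListNatBool comp_mem_FP)
open Literature.Computability.Complexity.CodeFP (pairE strE natE intE bitE unE rawE of_fn fst snd pairE_apply)
open Literature.Computability.Complexity.Brick (fstF sndF fstF_boolPair sndF_boolPair fstF_mem_FP sndF_mem_FP)
open Literature.Computability.Cryptography (CubicClassTable.WalkFns CubicClassTable.Inst)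
open Literature.Computability.Cryptography.CubicClassSampling (TableArgs tableArgsE instOfArgs PostArgs postArgsE postOfArgs)
open Literature.Computability.Cryptography.CubicClassStageParams

/-- **ASM helper `classStage_tab`** (registered): from an `FP` function computing the ladder class table on the argument
code `tableArgsE`, the table program `tab z v` of the quantum family — polynomial time in `⟨z, bin v⟩` and, on a family
input `z = ⟨⟨c₁₉(t), bin cap⟩, pad⟩`, equal to the code of `classTableOpQ (instOfArgs (t, cap, v)) cap v`:
`tab z v := F ⟨fstF (fstF z), ⟨sndF (fstF z), bin v⟩⟩`. -/
theorem classStage_tab :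
    ∀ (Fw : CubicClassTable.WalkFns),
      CodeFP tableArgsE (pairE (pairE natE (rawE intE)) natE) (fun q : TableArgs => Fw.classTableOpQ (instOfArgs q) q.2.1 q.2.2) →
      ∃ tab : List Bool → ℕ → List Bool, CodeFP (pairE strE natE) strE (fun p => tab p.1 p.2) ∧
        ∀ (t : ℕ × ℕ × ℕ × List ℕ × (ℕ × List ℤ) × ℕ × ℕ × ℕ × ℕ × ℕ × ℕ × ℕ × ℕ × ℕ × ℕ × ℕ × ℕ × ℕ × ℕ) (cap v : ℕ) (pad : List Bool),
          tab (boolPair (boolPair ((pairE natE (pairE natE (pairE natE (pairE (rawE natE) (pairE (pairE natE (rawE intE)) (pairE natE (pairE unE (pairE unE (pairE unE (pairE unE (pairE unE (pairE unE (pairE unE (pairE unE (pairE unE (pairE unE (pairE unE (pairE unE natE)))))))))))))))))) t) (natE cap)) pad) v =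
            pairE (pairE natE (rawE intE)) natE (Fw.classTableOpQ (instOfArgs (t, cap, v)) cap v) := by
  intro Fw hFw
  obtain ⟨F, hF, hFq⟩ := hFw
  have hF1 : CodeFP strE strE fstF := of_fn fstF fstF_mem_FP fun _ => rfl
  have hS1 : CodeFP strE strE sndF := of_fn sndF sndF_mem_FP fun _ => rfl
  have hz : CodeFP (pairE strE natE) strE (fun p => p.1) := fst _ _
  obtain ⟨g, hg, hge⟩ : CodeFP (pairE strE natE) (pairE strE (pairE strE natE))
      (fun p => (fstF (fstF p.1), (sndF (fstF p.1), p.2))) :=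
    ((hF1.comp (hF1.comp hz)).pair ((hS1.comp (hF1.comp hz)).pair (snd _ _)) :)
  refine ⟨fun z v => F (boolPair (fstF (fstF z)) (boolPair (sndF (fstF z)) (natE v))),
    ⟨F ∘ g, comp_mem_FP hF hg, fun p => ?_⟩, fun t cap v pad => ?_⟩
  · rw [Function.comp_apply, hge]; rfl
  · simp only [fstF_boolPair, sndF_boolPair]
    exact hFq (t, cap, v)

end Summit.QuantumAdvantage.QuantumAdvantage.Theorems.LinnikCubicClassGroups
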